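/-
Copyright (c) 2026 the pub-hodgecm-mathlib formalisation cell (harness21).  Prover seat hodgecm-mathlib-K2Liu-p13 (g4), Track B «K2-LIT»,
#184♮ = hLiu418 = `stmt-HodgeConjecture-24832`; Road I v3, U5 FACE-G, brick (E-g-fin) — the S2-K letter «EVERY K-TYPE `W_{(k+l,l)}` IS FINITE-DIMENSIONAL»
(the `[FiniteDimensional ℂ W]` input of ★∕📤 `K2LiuArchSWFiniteTypeRange.finiteDimensional_archDegPS_inf_pictureIn` for `W` built from K-types).
THEOREMS ONLY (no `def`, no `instance`, no named-fact hypothesis, no `sorry`).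
-/
import Summits.HodgeConjecture.HodgeConjecture.Theorems.K2LiuU22CompactPictureDefs     -- ★ S2-K `Carrier`, `uMat`, `dz`, `bil`, `kType`
import Mathlib.RingTheory.MvPolynomial.Basic                                           -- `restrictTotalDegree`, its `Module.Finite` instance
import Mathlib.LinearAlgebra.FiniteDimensional.Basic                                  -- `FiniteDimensional`, `Submodule.finiteDimensional_of_le`
import HarnessLib

/-!
# Crux `HLiu418`, organ S2-K: THE K-TYPES `W_{(k+l,l)} = D^l · span{(ξuη)^k}` ARE FINITE-DIMENSIONAL

Cell `hodgecm-mathlib`, crux item hLiu418 = `stmt-HodgeConjecture-24832` (helper lane, count-neutral).  ★ S2-K `kType k l := span_ℂ {D^l · (ξ·u·η)^k : ξ, η ∈ ℂ²}`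
(`K2LiuU22CompactPictureDefs`) is spanned by an infinite family; it is nevertheless finite-dimensional: `ξ·u·η` is the image of a polynomial of total degree `≤ 1` in the
four coordinates `X_{ij}`, so `(ξ·u·η)^k` is the image of a polynomial of total degree `≤ k`, and `W_{(k+l,l)} ≤ D^l · ι(ℂ[X]_{≤ k})` with `ℂ[X]_{≤k}` = Mathlib's
`restrictTotalDegree` (finite-dimensional).
* `bil_uMat_eq_algebraMap` — `ξ·u·η = ι(Σ_{ij} (ξ_i η_j)·X_{ij})`; `totalDegree_bilPoly_le` — that polynomial has total degree `≤ 1`;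
* **`kType_le`** — `W_{(k+l,l)} ≤ (D^l · ) '' ι '' ℂ[X]_{≤k}`; **`finiteDimensional_kType`** — `FiniteDimensional ℂ (kType k l)`.
Sources: [LeeZhu1998, §5 p. 5032]; [KashiwaraVergne1978, §II.5]; [Howe1989Remarks, §2].
HONEST LABEL.  Helper lemmas, count-neutral; `HC_CM` is proved only modulo the 7 printed citations (2 remaining named inputs:
hLiu418 = `stmt-HodgeConjecture-24832`, h413 = `stmt-HodgeConjecture-24833`) until rung 0 closes.
-/

set_option autoImplicit false
set_option linter.dupNamespace false -- the mandated namespace repeats `HodgeConjecture.HodgeConjecture`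

noncomputable section

open MvPolynomial
open Summit.HodgeConjecture.HodgeConjecture.Cruxes.HLiu418.K2LiuU22CompactPictureDefs

namespace Summit.HodgeConjecture.HodgeConjecture.Cruxes.HLiu418.K2LiuU22KTypeFiniteDimensional

/-- `ξ·u·η` is the image of the degree-one polynomial `Σ_{ij} (ξ_i η_j) • X_{ij}`. [cite: KashiwaraVergne1978, §II.5] -/
theorem bil_uMat_eq_algebraMap (ξ η : Fin 2 → ℂ) :
    bil uMat ξ η = (IsScalarTower.toAlgHom ℂ (MvPolynomial (Fin 2 × Fin 2) ℂ) Carrier) (∑ i : Fin 2, ∑ j : Fin 2, (ξ i * η j) • X (i, j)) := by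
  simp only [bil_apply, map_sum, map_smul, IsScalarTower.coe_toAlgHom', uMat_apply]

/-- that polynomial has total degree `≤ 1`. [folklore] -/
theorem totalDegree_bilPoly_le (ξ η : Fin 2 → ℂ) :
    (∑ i : Fin 2, ∑ j : Fin 2, (ξ i * η j) • X (i, j) : MvPolynomial (Fin 2 × Fin 2) ℂ).totalDegree ≤ 1 :=
  totalDegree_finsetSum_le fun i _ => totalDegree_finsetSum_le fun j _ =>
    (totalDegree_smul_le _ _).trans (totalDegree_X (R := ℂ) (i, j)).le

/-- **`W_{(k+l,l)} ≤ D^l · ι(ℂ[X]_{≤k})`**: every K-type lies in the (finite-dimensional) image of the polynomials of total degree `≤ k`, multiplied by `D^l`.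
[cite: LeeZhu1998, §5 p. 5032] [cite: KashiwaraVergne1978, §II.5] -/
theorem kType_le (k : ℕ) (l : ℤ) :
    kType k l ≤ ((restrictTotalDegree (Fin 2 × Fin 2) ℂ k).map
        (IsScalarTower.toAlgHom ℂ (MvPolynomial (Fin 2 × Fin 2) ℂ) Carrier).toLinearMap).map (LinearMap.mulLeft ℂ (dz l)) := by
  refine Submodule.span_le.2 ?_
  rintro f ⟨ξ, η, rfl⟩
  refine Submodule.mem_map.2 ⟨bil uMat ξ η ^ k, Submodule.mem_map.2 ⟨(∑ i : Fin 2, ∑ j : Fin 2, (ξ i * η j) • X (i, j)) ^ k, ?_, ?_⟩, rfl⟩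
  · rw [mem_restrictTotalDegree]
    exact (totalDegree_pow _ _).trans (by simpa using Nat.mul_le_mul_left k (totalDegree_bilPoly_le ξ η))
  · rw [AlgHom.toLinearMap_apply, map_pow, bil_uMat_eq_algebraMap]

/-- **THE K-TYPE `W_{(k+l,l)}` IS FINITE-DIMENSIONAL** (dimension `≤ C(k+3,3)`; in fact `(k+1)²`). [cite: LeeZhu1998, §5 p. 5032] [cite: Howe1989Remarks, §2] -/
theorem finiteDimensional_kType (k : ℕ) (l : ℤ) : FiniteDimensional ℂ (kType k l) :=
  Submodule.finiteDimensional_of_le (kType_le k l)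

end Summit.HodgeConjecture.HodgeConjecture.Cruxes.HLiu418.K2LiuU22KTypeFiniteDimensional

end
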